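import Literature.Topology.FourManifolds.ComplexProjectiveSpace
import Mathlib.Geometry.Manifold.LocalDiffeomorph
import Mathlib.Topology.Homotopy.Basic
import Mathlib.Topology.Homotopy.Contractible
import Mathlib.Analysis.Convex.Contractible
import Mathlib.Analysis.InnerProductSpace.PiL2
import Mathlib.Analysis.Complex.Basic

/-!
# Spheres in the affine axis part of a wedge sphere are null-homotopic
(registered helpers `helper_wedgeAxisNullHomotopicH` and `helper_wedgeAxisNullHomotopicV` of line
`cross-cap-laurent`, crux `GromovRecognitionRelEnd`, item stmt-SmoothPoincare4-11009)

In the wedge cap `X` the cap chart `ηH` (resp. `ηV`) is an injective local diffeomorphism on the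
open polydisc `D_H = {p 2 ^ 2 + p 3 ^ 2 < R₁⁻¹ ^ 2}` (resp. `D_V = {p 0 ^ 2 + p 1 ^ 2 < R₁⁻¹ ^ 2}`).
The affine part of the sphere at infinity `H∞` (resp. `V∞`) is the axis image
`A = range (z ↦ ηH (z.re, z.im, 0, 0))` (resp. `range (z ↦ ηV (0, 0, z.re, z.im))`); the axis lies
in the polydisc since `0 < R₁⁻¹ ^ 2`.  CLAIM: every continuous `G : ℂℙ¹ → X` with `range G ⊆ A`
is homotopic to a constant map.

Proof (abstract lemma `WedgeAxisNullHomotopic.nullhomotopic_of_range_subset`): write `e = η ∘ s`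
with `s : ℂ → ℝ⁴` the (continuous) slice and `η` the chart.  Lift `G` through the injective map
`e` to `g : ℂℙ¹ → ℂ` (`e (g q) = G q`).  The lift is continuous: `η` is a local homeomorphism on
the open set `D` (`IsLocalDiffeomorphOn.isLocalHomeomorphOn`), so near `s (g q₀)` it agrees with
an open partial homeomorphism `ψ` with `ψ.source ⊆ D`; on the neighbourhood `G ⁻¹' ψ.target` of
`q₀` injectivity of `η` on `D` gives `s ∘ g = ψ.symm ∘ G`, which is continuous, and `g` is
recovered from `s ∘ g` by the continuous projection `p ↦ p 0 + p 1 * I` (resp. `p 2 + p 3 * I`).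
Hence `G = E ∘ g` with `E = η ∘ s : ℂ → X` continuous and `ℂ` contractible, so `G` is
null-homotopic (`id_nullhomotopic`, `Nullhomotopic.comp_left/right`).

Everything is proved; no definition, no named fact.  Only Mathlib's local homeomorphism and
homotopy API is used.
-/

-- the prescribed namespace `Summit.<P>.<Sub>.…` duplicates `SmoothPoincare4` (P = Sub)
set_option linter.dupNamespace false

open Set Function Literature.Topology.FourManifolds
open scoped Manifold ContDiff Topology

namespace Summit.SmoothPoincare4.SmoothPoincare4.Theorems.GromovRecognitionRelEnd.CrossCapLaurent

namespace WedgeAxisNullHomotopic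

/-- **Maps into an embedded contractible slice are null-homotopic.**  Let `η : M → X` be a local
homeomorphism on an open set `D`, injective on `D`, let `A : V → M` be a continuous map of a
contractible space into `D` admitting a continuous left inverse `π`, and let `G : Y → X` be a
continuous map with `range G ⊆ range (η ∘ A)`.  Then `G` is homotopic to a constant map: the lift
of `G` through `η ∘ A` is continuous (locally it is `π ∘ ψ.symm ∘ G` for a local inverse `ψ.symm`
of `η`), so `G` factors through the contractible space `V`. [folklore] -/
theorem nullhomotopic_of_range_subset {M X Y V : Type*} [TopologicalSpace M]
    [TopologicalSpace X] [TopologicalSpace Y] [TopologicalSpace V] [ContractibleSpace V]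
    {D : Set M} (hD : IsOpen D) {η : M → X} (hloc : IsLocalHomeomorphOn η D) (hinj : InjOn η D)
    {A : V → M} (hA : Continuous A) (hAD : ∀ z, A z ∈ D) {π : M → V} (hπ : Continuous π)
    (hπA : ∀ z, π (A z) = z) (G : C(Y, X)) (hG : range G ⊆ range (fun z => η (A z))) :
    ∃ y : X, G.Homotopic (ContinuousMap.const _ y) := by
  -- the lift `g` of `G` through the injective map `η ∘ A`
  have hex : ∀ q, ∃ z, η (A z) = G q := fun q => hG (mem_range_self q)
  choose g hg using hex
  -- `A ∘ g` is continuous: near each point it is `ψ.symm ∘ G` for a local inverse of `η`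
  have hAg : Continuous fun q => A (g q) := by
    refine continuous_iff_continuousAt.2 fun q₀ => ?_
    obtain ⟨φ, hφ₀, hφ⟩ := hloc (A (g q₀)) (hAD _)
    obtain ⟨ψ, hψs, hψD, hψ⟩ : ∃ ψ : OpenPartialHomeomorph M X,
        A (g q₀) ∈ ψ.source ∧ ψ.source ⊆ D ∧ η = ψ :=
      ⟨φ.restrOpen D hD, ⟨hφ₀, hAD _⟩, inter_subset_right, hφ⟩
    have hq₀ : G q₀ ∈ ψ.target := by
      have h := ψ.map_source hψs
      rwa [← hψ, hg] at h
    have hN : G ⁻¹' ψ.target ∈ 𝓝 q₀ :=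
      G.continuous.continuousAt.preimage_mem_nhds (ψ.open_target.mem_nhds hq₀)
    have hEq : ∀ q, G q ∈ ψ.target → ψ.symm (G q) = A (g q) := fun q hq => by
      refine hinj (hψD (ψ.map_target hq)) (hAD _) ?_
      rw [hg q, hψ]
      exact ψ.right_inv hq
    have hc : ContinuousOn (fun q => ψ.symm (G q)) (G ⁻¹' ψ.target) :=
      ψ.continuousOn_symm.comp G.continuous.continuousOn fun q hq => hq
    exact (hc.continuousAt hN).congr (Filter.eventuallyEq_of_mem hN fun q hq => hEq q hq)
  -- hence `g = π ∘ (A ∘ g)` is continuous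
  have hgc : Continuous g := by
    have h : g = fun q => π (A (g q)) := funext fun q => (hπA (g q)).symm
    rw [h]
    exact hπ.comp hAg
  -- `G = E ∘ g` with `E = η ∘ A : V → X` continuous and `V` contractible
  obtain ⟨E, hE⟩ : ∃ E : C(V, X), ∀ z, E z = η (A z) :=
    ⟨⟨fun z => η (A z), hloc.continuousOn.comp_continuous hA hAD⟩, fun _ => rfl⟩
  obtain ⟨gC, hgC⟩ : ∃ gC : C(Y, V), ∀ q, gC q = g q := ⟨⟨g, hgc⟩, fun _ => rfl⟩
  have hGE : G = E.comp gC := by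
    ext q
    rw [ContinuousMap.comp_apply, hgC, hE, hg]
  have h1 : gC.Nullhomotopic := by
    have h := (id_nullhomotopic V).comp_left gC
    rwa [ContinuousMap.id_comp] at h
  have h2 : (E.comp gC).Nullhomotopic := h1.comp_right E
  rw [hGE]
  exact h2

end WedgeAxisNullHomotopic

/-- **Registered helper `helper_wedgeAxisNullHomotopicH`** (line `cross-cap-laurent`, signature
verbatim): if the cap chart `ηH` is an injective local diffeomorphism on the polydisc
`{p 2 ^ 2 + p 3 ^ 2 < R₁⁻¹ ^ 2}`, then every continuous map `G : ℂℙ¹ → X` with range in the axis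
image `range (z ↦ ηH (z.re, z.im, 0, 0))` (the affine part of the sphere at infinity `H∞`) is
homotopic to a constant map.  See the file header for the proof. [folklore] -/
theorem helper_wedgeAxisNullHomotopicH : ∀ (X : Type) [TopologicalSpace X] [ChartedSpace (EuclideanSpace ℝ (Fin 4)) X] [IsManifold (𝓡 4) ∞ X] (R₁ : ℝ) (ηH : EuclideanSpace ℝ (Fin 4) → X), 0 < R₁ → IsLocalDiffeomorphOn 𝓘(ℝ, EuclideanSpace ℝ (Fin 4)) (𝓡 4) ∞ ηH {p : EuclideanSpace ℝ (Fin 4) | p 2 ^ 2 + p 3 ^ 2 < R₁⁻¹ ^ 2} → Set.InjOn ηH {p : EuclideanSpace ℝ (Fin 4) | p 2 ^ 2 + p 3 ^ 2 < R₁⁻¹ ^ 2} → ∀ G : C(ComplexProjectiveSpace 1, X), Set.range G ⊆ Set.range (fun z : ℂ => ηH (WithLp.toLp 2 ![z.re, z.im, 0, 0])) → ∃ y : X, G.Homotopic (ContinuousMap.const _ y) := by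
  intro X _ _ _ R₁ ηH hR₁ hloc hinj G hG
  have hR : (0 : ℝ) < R₁⁻¹ ^ 2 := by positivity
  have hcoord : ∀ i : Fin 4, Continuous fun p : EuclideanSpace ℝ (Fin 4) => p i :=
    fun i => (continuous_apply i).comp (PiLp.continuous_ofLp 2 _)
  -- the polydisc is open
  have hD : IsOpen {p : EuclideanSpace ℝ (Fin 4) | p 2 ^ 2 + p 3 ^ 2 < R₁⁻¹ ^ 2} :=
    isOpen_lt (((hcoord 2).pow 2).add ((hcoord 3).pow 2)) continuous_const
  -- the slice `z ↦ (z, 0)` is continuous, lands in the polydisc, and `p ↦ p 0 + p 1 * I` inverts it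
  have hA : Continuous fun z : ℂ =>
      (WithLp.toLp 2 ![z.re, z.im, 0, 0] : EuclideanSpace ℝ (Fin 4)) := by
    refine (PiLp.continuous_toLp 2 _).comp (continuous_pi fun i => ?_)
    fin_cases i
    · exact Complex.continuous_re
    · exact Complex.continuous_im
    · exact continuous_const
    · exact continuous_const
  have hAD : ∀ z : ℂ, (WithLp.toLp 2 ![z.re, z.im, 0, 0] : EuclideanSpace ℝ (Fin 4)) ∈
      {p : EuclideanSpace ℝ (Fin 4) | p 2 ^ 2 + p 3 ^ 2 < R₁⁻¹ ^ 2} := fun z => by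
    simpa using hR
  have hπ : Continuous
      fun p : EuclideanSpace ℝ (Fin 4) => ((p 0 : ℝ) : ℂ) + (p 1 : ℝ) * Complex.I :=
    (Complex.continuous_ofReal.comp (hcoord 0)).add
      ((Complex.continuous_ofReal.comp (hcoord 1)).mul continuous_const)
  have hπA : ∀ z : ℂ, (((WithLp.toLp 2 ![z.re, z.im, 0, 0] : EuclideanSpace ℝ (Fin 4)) 0 : ℝ) : ℂ)
      + ((WithLp.toLp 2 ![z.re, z.im, 0, 0] : EuclideanSpace ℝ (Fin 4)) 1 : ℝ) * Complex.I = z :=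
    fun z => by simp [Complex.re_add_im]
  exact WedgeAxisNullHomotopic.nullhomotopic_of_range_subset hD hloc.isLocalHomeomorphOn hinj hA hAD
    hπ hπA G hG

/-- **Registered helper `helper_wedgeAxisNullHomotopicV`** (line `cross-cap-laurent`, signature
verbatim): if the cap chart `ηV` is an injective local diffeomorphism on the polydisc
`{p 0 ^ 2 + p 1 ^ 2 < R₁⁻¹ ^ 2}`, then every continuous map `G : ℂℙ¹ → X` with range in the axis
image `range (z ↦ ηV (0, 0, z.re, z.im))` (the affine part of the sphere at infinity `V∞`) is
homotopic to a constant map.  Mirror image of `helper_wedgeAxisNullHomotopicH`. [folklore] -/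
theorem helper_wedgeAxisNullHomotopicV : ∀ (X : Type) [TopologicalSpace X] [ChartedSpace (EuclideanSpace ℝ (Fin 4)) X] [IsManifold (𝓡 4) ∞ X] (R₁ : ℝ) (ηV : EuclideanSpace ℝ (Fin 4) → X), 0 < R₁ → IsLocalDiffeomorphOn 𝓘(ℝ, EuclideanSpace ℝ (Fin 4)) (𝓡 4) ∞ ηV {p : EuclideanSpace ℝ (Fin 4) | p 0 ^ 2 + p 1 ^ 2 < R₁⁻¹ ^ 2} → Set.InjOn ηV {p : EuclideanSpace ℝ (Fin 4) | p 0 ^ 2 + p 1 ^ 2 < R₁⁻¹ ^ 2} → ∀ G : C(ComplexProjectiveSpace 1, X), Set.range G ⊆ Set.range (fun z : ℂ => ηV (WithLp.toLp 2 ![0, 0, z.re, z.im])) → ∃ y : X, G.Homotopic (ContinuousMap.const _ y) := by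
  intro X _ _ _ R₁ ηV hR₁ hloc hinj G hG
  have hR : (0 : ℝ) < R₁⁻¹ ^ 2 := by positivity
  have hcoord : ∀ i : Fin 4, Continuous fun p : EuclideanSpace ℝ (Fin 4) => p i :=
    fun i => (continuous_apply i).comp (PiLp.continuous_ofLp 2 _)
  -- the polydisc is open
  have hD : IsOpen {p : EuclideanSpace ℝ (Fin 4) | p 0 ^ 2 + p 1 ^ 2 < R₁⁻¹ ^ 2} :=
    isOpen_lt (((hcoord 0).pow 2).add ((hcoord 1).pow 2)) continuous_const
  -- the slice `z ↦ (0, z)` is continuous, lands in the polydisc, and `p ↦ p 2 + p 3 * I` inverts it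
  have hA : Continuous fun z : ℂ =>
      (WithLp.toLp 2 ![0, 0, z.re, z.im] : EuclideanSpace ℝ (Fin 4)) := by
    refine (PiLp.continuous_toLp 2 _).comp (continuous_pi fun i => ?_)
    fin_cases i
    · exact continuous_const
    · exact continuous_const
    · exact Complex.continuous_re
    · exact Complex.continuous_im
  have hAD : ∀ z : ℂ, (WithLp.toLp 2 ![0, 0, z.re, z.im] : EuclideanSpace ℝ (Fin 4)) ∈
      {p : EuclideanSpace ℝ (Fin 4) | p 0 ^ 2 + p 1 ^ 2 < R₁⁻¹ ^ 2} := fun z => by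
    simpa using hR
  have hπ : Continuous
      fun p : EuclideanSpace ℝ (Fin 4) => ((p 2 : ℝ) : ℂ) + (p 3 : ℝ) * Complex.I :=
    (Complex.continuous_ofReal.comp (hcoord 2)).add
      ((Complex.continuous_ofReal.comp (hcoord 3)).mul continuous_const)
  have hπA : ∀ z : ℂ, (((WithLp.toLp 2 ![0, 0, z.re, z.im] : EuclideanSpace ℝ (Fin 4)) 2 : ℝ) : ℂ)
      + ((WithLp.toLp 2 ![0, 0, z.re, z.im] : EuclideanSpace ℝ (Fin 4)) 3 : ℝ) * Complex.I = z :=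
    fun z => by simp [Complex.re_add_im]
  exact WedgeAxisNullHomotopic.nullhomotopic_of_range_subset hD hloc.isLocalHomeomorphOn hinj hA hAD
    hπ hπA G hG

end Summit.SmoothPoincare4.SmoothPoincare4.Theorems.GromovRecognitionRelEnd.CrossCapLaurent
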